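import Mathlib
import Literature.MathematicalPhysics.StatisticalMechanics.PeriodicConfigurationSums

/-!
# `ExactCertificate` (stmt-AtomisticToContinuum-11959), line `closure-makes-nogap-exact`:
# the zero-pressure (virial) identity and the explicit dilation excess (`stub_zeroPressure`)

Support file for the crux `ThreeConeCertificate.ExactCertificate`.  A witness template `P` of the
crux is a periodic minimiser of the Lennard-Jones energy per particle, hence does not gain energy
under dilation; in potential form (the dilated configuration `t • P` has energy
`e_{V(t·)}(P)`), `e_LJ(P) ≤ e_{LJ(t·)}(P)` for all `t > 0`.  This file proves what follows from
that inequality alone, for ANY periodic configuration `P` of `ℝ³`: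

* `energyPerParticle_const_mul`, `energyPerParticle_sub` — linearity of the energy per particle
  `e_W(P) = (2·#F)⁻¹ Σ_{x ∈ F} Σ'_{y ∈ P, y ≠ x} W(|x − y|)` in the potential (subtraction needs
  summable site families, since the inner lattice sum is a `tsum`);
* `energyPerParticle_lennardJones_dilate` — the DILATION CURVE is an explicit two-term function of
  `t`: `e_{LJ(t·)}(P) = (1/12) t⁻¹² e₁₂(P) − (1/6) t⁻⁶ e₆(P)` with the per-particle lattice sums
  `e₆ = e_{r⁻⁶}(P)`, `e₁₂ = e_{r⁻¹²}(P)` (absolutely convergent in `d = 3`,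
  `PeriodicConfiguration.summable_inv_pow_dist`);
* `eq_of_forall_dilationCurve_le` — Fermat at `t = 1` for the two-term curve: if
  `ψ(t) = (1/12) t⁻¹² a − (1/6) t⁻⁶ b` satisfies `ψ(1) ≤ ψ(t)` for all `t > 0` then `b = a`
  (`ψ'(1) = −a + b = 0`, `IsLocalMin.hasDerivAt_eq_zero`);
* **`stub_zeroPressure`** (registered stub of the line skeleton) — (i) the VIRIAL IDENTITY
  `e₆(P) = e₁₂(P)`, (ii) `e_LJ(P) = −e₆(P)/12`, (iii) the DILATION EXCESS
  `e_{LJ(t·)}(P) − e_LJ(P) = (e₆(P)/12)(t⁻⁶ − 1)²` for every `t > 0`.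

All `[folklore]` (zero-pressure / virial relation for homogeneous two-term pair potentials;
cf. X. Blanc, M. Lewin, *The crystallization conjecture: a review*, EMS Surv. Math. Sci. 2 (2015),
§2.5, lattice energies as Epstein-zeta-type series).  Not here: the existence of the dilated
periodic configuration `t • P` (sibling stub `stub_dilate`) and anything about minimisers.
-/

noncomputable section

namespace Summit.AtomisticToContinuum.Crystallization.Theorems.ThreeConeCertificateExactCertificate.Dilation

open Literature.MathematicalPhysics.StatisticalMechanics
open scoped BigOperators Topology
open Filter Set

/-! ## Linearity of the energy per particle in the potential -/

/-- Homogeneity of the energy per particle in the potential: `e_{c·W}(P) = c · e_W(P)` (no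
summability needed: `tsum_mul_left` is unconditional). [folklore] -/
theorem energyPerParticle_const_mul (P : PeriodicConfiguration 3) (c : ℝ) (W : ℝ → ℝ) :
    P.energyPerParticle (fun r => c * W r) = c * P.energyPerParticle W := by
  unfold PeriodicConfiguration.energyPerParticle
  simp only [tsum_mul_left, ← Finset.mul_sum]
  ring

/-- Additivity of the energy per particle under subtraction of potentials with summable site
families: `e_{W₁ − W₂}(P) = e_{W₁}(P) − e_{W₂}(P)`. [folklore] -/
theorem energyPerParticle_sub (P : PeriodicConfiguration 3) {W₁ W₂ : ℝ → ℝ}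
    (h₁ : ∀ x ∈ P.motif, Summable fun q : {y : EuclideanSpace ℝ (Fin 3) // y ∈ P.points ∧ y ≠ x} =>
      W₁ (dist x q.1))
    (h₂ : ∀ x ∈ P.motif, Summable fun q : {y : EuclideanSpace ℝ (Fin 3) // y ∈ P.points ∧ y ≠ x} =>
      W₂ (dist x q.1)) :
    P.energyPerParticle (fun r => W₁ r - W₂ r) = P.energyPerParticle W₁ - P.energyPerParticle W₂ := by
  unfold PeriodicConfiguration.energyPerParticle
  rw [← mul_sub, ← Finset.sum_sub_distrib]
  congr 1
  exact Finset.sum_congr rfl fun x hx => (h₁ x hx).tsum_sub (h₂ x hx)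

/-- **The dilation curve of the Lennard-Jones energy per particle is an explicit two-term
function**: for every periodic configuration `P` of `ℝ³` and every real `t`,
`e_{LJ(t·)}(P) = (1/12) t⁻¹² e_{r⁻¹²}(P) − (1/6) t⁻⁶ e_{r⁻⁶}(P)` (both lattice sums converge
absolutely in `d = 3`; `(t r)⁻ⁿ = t⁻ⁿ r⁻ⁿ`; for `t = 0` both sides vanish by `0⁻¹ = 0`).
[folklore] -/
theorem energyPerParticle_lennardJones_dilate (P : PeriodicConfiguration 3) (t : ℝ) :
    P.energyPerParticle (fun r => lennardJones (t * r)) =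
      (1 / 12) * (t⁻¹) ^ 12 * P.energyPerParticle (fun r => (r⁻¹) ^ 12) -
        (1 / 6) * (t⁻¹) ^ 6 * P.energyPerParticle (fun r => (r⁻¹) ^ 6) := by
  have hfun : (fun r => lennardJones (t * r)) =
      fun r => (1 / 12) * (t⁻¹) ^ 12 * (r⁻¹) ^ 12 - (1 / 6) * (t⁻¹) ^ 6 * (r⁻¹) ^ 6 := by
    funext r
    simp only [lennardJones, mul_inv, mul_pow]
    ring
  have h12 : ∀ x ∈ P.motif,
      Summable fun q : {y : EuclideanSpace ℝ (Fin 3) // y ∈ P.points ∧ y ≠ x} =>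
        (1 / 12) * (t⁻¹) ^ 12 * ((dist x q.1)⁻¹) ^ 12 := fun x _ =>
    (P.summable_inv_pow_dist (by norm_num) x).mul_left _
  have h6 : ∀ x ∈ P.motif,
      Summable fun q : {y : EuclideanSpace ℝ (Fin 3) // y ∈ P.points ∧ y ≠ x} =>
        (1 / 6) * (t⁻¹) ^ 6 * ((dist x q.1)⁻¹) ^ 6 := fun x _ =>
    (P.summable_inv_pow_dist (by norm_num) x).mul_left _
  rw [hfun, energyPerParticle_sub P (W₁ := fun r => (1 / 12) * (t⁻¹) ^ 12 * (r⁻¹) ^ 12)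
    (W₂ := fun r => (1 / 6) * (t⁻¹) ^ 6 * (r⁻¹) ^ 6) h12 h6,
    energyPerParticle_const_mul, energyPerParticle_const_mul]

/-- The Lennard-Jones energy per particle in terms of the two lattice sums:
`e_LJ(P) = (1/12) e_{r⁻¹²}(P) − (1/6) e_{r⁻⁶}(P)` (the dilation curve at `t = 1`). [folklore] -/
theorem energyPerParticle_lennardJones_eq (P : PeriodicConfiguration 3) :
    P.energyPerParticle lennardJones =
      (1 / 12) * P.energyPerParticle (fun r => (r⁻¹) ^ 12) -
        (1 / 6) * P.energyPerParticle (fun r => (r⁻¹) ^ 6) := by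
  have h := energyPerParticle_lennardJones_dilate P 1
  have h1 : (fun r : ℝ => lennardJones (1 * r)) = lennardJones := funext fun r => by rw [one_mul]
  rw [h1, inv_one, one_pow, one_pow, mul_one, mul_one] at h
  exact h

/-! ## Fermat at `t = 1` for the two-term dilation curve -/

/-- **Fermat's theorem for the dilation curve.**  If `ψ(t) = (1/12) t⁻¹² a − (1/6) t⁻⁶ b` for all
`t` and `ψ(1) ≤ ψ(t)` for all `t > 0`, then `b = a`: `ψ` has a local minimum at the interior point
`1` of `(0, ∞)`, so `ψ'(1) = −a + b = 0` (`IsLocalMin.hasDerivAt_eq_zero`). [folklore] -/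
theorem eq_of_forall_dilationCurve_le {a b : ℝ} (ψ : ℝ → ℝ)
    (hψ : ∀ t, ψ t = (1 / 12) * (t⁻¹) ^ 12 * a - (1 / 6) * (t⁻¹) ^ 6 * b)
    (h : ∀ t : ℝ, 0 < t → ψ 1 ≤ ψ t) : b = a := by
  obtain rfl : ψ = fun t => (1 / 12) * (t⁻¹) ^ 12 * a - (1 / 6) * (t⁻¹) ^ 6 * b := funext hψ
  have hloc : IsLocalMin (fun t : ℝ => (1 / 12) * (t⁻¹) ^ 12 * a - (1 / 6) * (t⁻¹) ^ 6 * b) 1 :=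
    Filter.eventually_of_mem (Ioi_mem_nhds one_pos) fun t ht => h t ht
  have hinv : HasDerivAt (fun y : ℝ => y⁻¹) (-((1 : ℝ) ^ 2)⁻¹) 1 := hasDerivAt_inv one_ne_zero
  have hder := (((hinv.fun_pow 12).const_mul (1 / 12)).mul_const a).fun_sub
    (((hinv.fun_pow 6).const_mul (1 / 6)).mul_const b)
  have h0 := hloc.hasDerivAt_eq_zero hder
  norm_num at h0
  linarith

/-! ## The registered stub -/

/-- **`stub_zeroPressure` — the virial identity and the explicit dilation excess.**  If a periodic
configuration `P` of `ℝ³` does not gain energy when the Lennard-Jones potential is dilated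
(`e_LJ(P) ≤ e_{LJ(t·)}(P)` for all `t > 0`; this holds for every periodic minimiser, in particular
for every witness template of the crux `ExactCertificate`), then, with the per-particle lattice
sums `e₆(P) = e_{r⁻⁶}(P)`, `e₁₂(P) = e_{r⁻¹²}(P)` (absolutely convergent,
`PeriodicConfiguration.summable_inv_pow_dist`):
(i) ZERO PRESSURE / VIRIAL: `e₆(P) = e₁₂(P)`; (ii) `e_LJ(P) = −e₆(P)/12`; (iii) for every
`t > 0`, `e_{LJ(t·)}(P) − e_LJ(P) = (e₆(P)/12)·(t⁻⁶ − 1)²`.  Proof: the dilation curve is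
`φ(t) = (e₁₂/12) t⁻¹² − (e₆/6) t⁻⁶` by linearity of the lattice sums
(`energyPerParticle_lennardJones_dilate`); `φ ≥ φ(1)` on `(0, ∞)` forces
`φ'(1) = −e₁₂ + e₆ = 0` (`eq_of_forall_dilationCurve_le`); then algebra. [folklore] -/
theorem stub_zeroPressure : ∀ P : PeriodicConfiguration 3,
    (∀ t : ℝ, 0 < t →
      P.energyPerParticle lennardJones ≤ P.energyPerParticle (fun r => lennardJones (t * r))) →
    P.energyPerParticle (fun r => (r⁻¹) ^ 6) = P.energyPerParticle (fun r => (r⁻¹) ^ 12) ∧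
    P.energyPerParticle lennardJones = -(1 / 12) * P.energyPerParticle (fun r => (r⁻¹) ^ 6) ∧
    ∀ t : ℝ, 0 < t →
      P.energyPerParticle (fun r => lennardJones (t * r)) - P.energyPerParticle lennardJones =
        (1 / 12) * P.energyPerParticle (fun r => (r⁻¹) ^ 6) * ((t⁻¹) ^ 6 - 1) ^ 2 := by
  intro P hmin
  have hφ := energyPerParticle_lennardJones_dilate P
  have hLJ := energyPerParticle_lennardJones_eq P
  have h1 : (fun r : ℝ => lennardJones (1 * r)) = lennardJones := funext fun r => by rw [one_mul]
  have hvir : P.energyPerParticle (fun r => (r⁻¹) ^ 6) = P.energyPerParticle (fun r => (r⁻¹) ^ 12) :=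
    eq_of_forall_dilationCurve_le (fun t => P.energyPerParticle (fun r => lennardJones (t * r))) hφ
      fun t ht => by simpa only [h1] using hmin t ht
  refine ⟨hvir, ?_, fun t _ => ?_⟩
  · rw [hLJ, ← hvir]
    ring
  · rw [hφ t, hLJ, ← hvir]
    ring

end Summit.AtomisticToContinuum.Crystallization.Theorems.ThreeConeCertificateExactCertificate.Dilation

end
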